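/-
Copyright (c) 2026. All rights reserved.
Released under Apache 2.0 license as described in the file LICENSE.
Authors: abc-iut cell, prover seat abc-iut-w5-d038 (gen 8; PROOF-ONLY: the COMPARISON step of
«punctures exhaust the cusps» — a cusp of the Möbius deck group going out to a puncture is conjugate
to a power of the chart end's monodromy; row «FC-TOPOLOGICAL» (L4-lead m122), successor of
abc-iut-w6-d031's «FC-ROUTE»).
-/
import Literature.AnabelianGeometry.AbsoluteAnabelian.ArchimedeanHolFieldFunctorGeometricPSLCuspHeightBound
import Literature.AnabelianGeometry.AbsoluteAnabelian.ArchimedeanHolFieldFunctorGeometricPSLCuspChartEnd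
import Literature.Analysis.Complex.RealParabolicConjugate
import Literature.Analysis.Complex.HolomorphicLogarithm
import HarnessLib

/-!
# Punctures exhaust the cusps, I: a cusp over a puncture is conjugate to a power of the chart end

S. Mochizuki, *Topics in Absolute Anabelian Geometry III*, proof of Prop. 4.2 (i) (p. 106): at the
uniformised model `X = ℍ/Λ̄` of a hyperbolic Riemann surface of finite type the automorphism group
`N_{PSL₂(ℝ)}(Λ̄)/Λ̄` is FINITE.  In the tree this is abc-iut-L4-d1's
`HolRS.finiteIndex_subgroupOf_normalizer_of_cusps` (p460349) from (P) «a parabolic element» and (FC)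
«finitely many `Λ̄`-classes of cusps»; abc-iut-w6-d031 proved (P) for the ABSTRACT Möbius deck group of
every uniformising `k : ℍ → M ∖ S` (p476737).  This file proves (FC) — classically «the cusps of the
Fuchsian model of `M ∖ S` correspond to the punctures» (H. M. Farkas, I. Kra, *Riemann Surfaces* IV.6;
G. Shimura, *Introduction to the Arithmetic Theory of Automorphic Functions* §1.5) — for every COMPACT
Riemann surface `M` and finite `S`, by a Picard-free route:

* `HolRS.exists_conj_zpow_of_tendsto` — **COMPARISON**: if the horoball of a cusp `A • ∞`
  (`π(A T_h A⁻¹) = π t ∈ Λ̄`) goes out to the puncture `s` (abc-iut-w5-d038's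
  `exists_tendsto_nhds_puncture`, Shimizu route), then `π t · μ = μ · qⁿ` in `Λ̄` for the monodromy `q`
  of the chart end at `s` (abc-iut-w6-d031's lift `exists_lift_deck_of_periodic`, p479666): a holomorphic
  logarithm of the chart coordinate of `k ∘ A` on a deep half-plane (the tree's `HolomorphicLogarithm`)
  is a second `k`-lift, and lifts through a covering agree up to a deck transformation
  (`IsCoveringMap.eq_of_comp_eq`);
* `HolRS.exists_psl_conj_translSL_eq` — straightening a parabolic element in `PSL₂(ℝ)`
  (abc-iut-w6-d031's `SL2R.exists_conj_smul_eq_add`, p480155); `HolRS.psl_mk_ne_one_of_isParabolic`,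
  `HolRS.trace_sq_eq_four_of_isParabolic`.

The sequel `…PSLCuspClasses.lean` assembles (FC) itself (`HolRS.cuspClasses_finite`).
PROOF-ONLY (no definition, no instance, no named fact); MODEL side of [AbsTopIII] §4 (model ≠
reconstruction); classical; nothing here bears on the disputed [IUTchIII] Cor. 3.12.

## References

* S. Mochizuki, *Topics in Absolute Anabelian Geometry III* (2015), proof of Prop. 4.2 (i) p.106.
  [MochizukiAbsTopIII2015]
* H. M. Farkas, I. Kra, *Riemann Surfaces*, 2nd ed. (1992), IV.5.5–IV.5.6, IV.6. [FarkasKra1992]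
* G. Shimura, *Introduction to the Arithmetic Theory of Automorphic Functions* (1971), §1.5. [Shimura1971]
-/

set_option autoImplicit false

noncomputable section

open Complex Filter Topology Metric Set Function
open scoped UpperHalfPlane MatrixGroups Matrix Manifold ContDiff Real
open _root_.TopologicalSpace (Opens)
open UpperHalfPlane (upperHalfPlaneSet isOpen_upperHalfPlaneSet)
open Literature.NumberTheory.Automorphic.Fuchsian (translSL)
open Literature.Geometry.Kaehler (ComplexTorus)

namespace Literature.AnabelianGeometry.AbsoluteAnabelian

namespace HolRS

/-! ### §0 Small facts on `SL(2, ℝ)`, `PSL₂(ℝ)` and `ℍ` -/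

/-- A parabolic element of `SL(2, ℝ)` is non-trivial in `PSL₂(ℝ)`. [cite: Shimura1971, §1.3] -/
theorem psl_mk_ne_one_of_isParabolic {t : SL(2, ℝ)} (ht : (t : Matrix (Fin 2) (Fin 2) ℝ).IsParabolic) :
    (QuotientGroup.mk' (Subgroup.center SL(2, ℝ)) t : PSL2R) ≠ 1 := by
  intro h1
  rw [QuotientGroup.mk'_apply, ← QuotientGroup.mk_one, QuotientGroup.eq, mul_one] at h1
  have ht1 : t ∈ Subgroup.center SL(2, ℝ) := by simpa using (Subgroup.center SL(2, ℝ)).inv_mem h1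
  apply ht.1
  rcases mem_center_sl_iff.mp ht1 with rfl | rfl
  · exact ⟨1, by simp⟩
  · exact ⟨-1, by rw [map_neg, map_one, Matrix.SpecialLinearGroup.coe_neg, Matrix.SpecialLinearGroup.coe_one]⟩

/-- The trace condition of a parabolic element of `SL(2, ℝ)`: `(a + d)² = 4`. [cite: Shimura1971, §1.3] -/
theorem trace_sq_eq_four_of_isParabolic {t : SL(2, ℝ)} (ht : (t : Matrix (Fin 2) (Fin 2) ℝ).IsParabolic) :
    (t 0 0 + t 1 1) ^ 2 = 4 := by
  have h := ht.2
  rw [Matrix.discr_fin_two, Matrix.trace_fin_two, Matrix.SpecialLinearGroup.det_coe] at h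
  have : ((t : Matrix (Fin 2) (Fin 2) ℝ) 0 0 + (t : Matrix (Fin 2) (Fin 2) ℝ) 1 1) ^ 2 = 4 := by
    linarith
  exact this

/-- The translation `T_h` acts by `τ ↦ τ + h`. [folklore] -/
private theorem coe_translSL_smul (h : ℝ) (τ : ℍ) : (((translSL h) • τ : ℍ) : ℂ) = τ + h := by
  rw [UpperHalfPlane.coe_specialLinearGroup_apply]
  simp [Literature.NumberTheory.Automorphic.Fuchsian.translSL_apply_00,
    Literature.NumberTheory.Automorphic.Fuchsian.translSL_apply_01,
    Literature.NumberTheory.Automorphic.Fuchsian.translSL_apply_10,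
    Literature.NumberTheory.Automorphic.Fuchsian.translSL_apply_11]

/-- A point of `ℍ` translated by a real number. [folklore] -/
private theorem exists_coe_eq_add (τ : ℍ) (x : ℝ) : ∃ σ : ℍ, (σ : ℂ) = τ + x :=
  ⟨UpperHalfPlane.mk ((τ : ℂ) + x) (by simpa using τ.im_pos), rfl⟩

/-- Points of `ℍ` of arbitrarily large height. [folklore] -/
private theorem exists_lt_im' (C : ℝ) : ∃ τ : ℍ, C < τ.im := by
  refine ⟨UpperHalfPlane.mk (((max C 0 + 1 : ℝ) : ℂ) * I) (by simp; positivity), ?_⟩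
  rw [UpperHalfPlane.im, UpperHalfPlane.coe_mk]
  simp only [mul_im, ofReal_re, I_im, mul_one, ofReal_im, I_re, mul_zero, add_zero]
  linarith [le_max_left C 0]

/-- The half-plane `{Im τ > C}` of `ℍ` is preconnected. [folklore] -/
private theorem isPreconnected_setOf_lt_im' (C : ℝ) : IsPreconnected {τ : ℍ | C < τ.im} := by
  rw [← UpperHalfPlane.isEmbedding_coe.isInducing.isPreconnected_image]
  have : ((↑) : ℍ → ℂ) '' {τ : ℍ | C < τ.im} = {w : ℂ | max C 0 < w.im} := by
    ext w
    constructor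
    · rintro ⟨τ, hτ, rfl⟩
      exact max_lt hτ τ.im_pos
    · intro hw
      have hw' : max C 0 < w.im := hw
      refine ⟨UpperHalfPlane.mk w (lt_of_le_of_lt (le_max_right _ _) hw'), ?_, rfl⟩
      exact lt_of_le_of_lt (le_max_left _ _) hw'
  rw [this]
  exact (convex_halfSpace_im_gt _).isPreconnected

/-- **Straightening a parabolic element**: `π(A T_h A⁻¹) = π t` for some `A ∈ SL(2, ℝ)` and `h ≠ 0`
(abc-iut-w6-d031's `SL2R.exists_conj_smul_eq_add`, p480155, read in `PSL₂(ℝ)` through the faithful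
action). [cite: Shimura1971, §1.3] -/
theorem exists_psl_conj_translSL_eq {t : SL(2, ℝ)} (ht : (t : Matrix (Fin 2) (Fin 2) ℝ).IsParabolic) :
    ∃ (A : SL(2, ℝ)) (h : ℝ), h ≠ 0 ∧
      (QuotientGroup.mk' (Subgroup.center SL(2, ℝ)) (A * translSL h * A⁻¹) : PSL2R) =
        QuotientGroup.mk' (Subgroup.center SL(2, ℝ)) t := by
  obtain ⟨A₀, h, hA₀⟩ :=
    Literature.Analysis.Complex.SL2R.exists_conj_smul_eq_add t (trace_sq_eq_four_of_isParabolic ht)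
  -- `A₀ t A₀⁻¹` and `T_h` act identically, hence agree in `PSL₂(ℝ)`
  have heq : (QuotientGroup.mk' (Subgroup.center SL(2, ℝ)) (translSL h) : PSL2R) =
      QuotientGroup.mk' (Subgroup.center SL(2, ℝ)) (A₀ * t * A₀⁻¹) := by
    rw [← inv_mul_eq_one]
    refine psl_eq_one_of_forall_smul_eq fun τ => ?_
    rw [mul_smul, QuotientGroup.mk'_apply, QuotientGroup.mk'_apply, psl_mk_smul,
      ← QuotientGroup.mk_inv, psl_mk_smul, inv_smul_eq_iff]
    exact UpperHalfPlane.ext (by rw [hA₀ τ, coe_translSL_smul])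
  refine ⟨A₀⁻¹, h, ?_, ?_⟩
  · -- `h ≠ 0`: otherwise `t` would be trivial in `PSL₂(ℝ)`
    rintro rfl
    apply psl_mk_ne_one_of_isParabolic ht
    have h1 : (QuotientGroup.mk' (Subgroup.center SL(2, ℝ)) (A₀ * t * A₀⁻¹) : PSL2R) = 1 := by
      rw [← heq]
      refine psl_eq_one_of_forall_smul_eq fun τ => UpperHalfPlane.ext ?_
      rw [QuotientGroup.mk'_apply, psl_mk_smul, coe_translSL_smul, ofReal_zero, add_zero]
    rwa [map_mul, map_mul, map_inv, conj_eq_one_iff] at h1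
  · rw [map_mul, map_mul, inv_inv, map_inv, heq, map_mul, map_mul, map_inv]
    group

/-! ### §1 The comparison: a cusp over the puncture `s` versus the chart end at `s` -/

section Compare

variable {M : Type} [TopologicalSpace M] [T2Space M] [ChartedSpace ℂ M] [IsManifold 𝓘(ℂ, ℂ) ω M]

/-- ★ **Comparison of a cusp with the chart end.**  Let `k : ℍ → U ⊆ M` be a holomorphic covering whose
Möbius deck group `Λ̄` (membership criterion) acts freely and transitively on the fibres; let `G̃` be a
`k`-lift of the chart end at the puncture `s ∉ U` — `k (G̃ w) = φ⁻¹ (φ s + (r/2) e^{2πiw})`,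
`G̃ (w + 1) = q • G̃ w`, `q ∈ Λ̄` — and let `A • ∞` be a cusp of `Λ̄` (`π(A T_h A⁻¹) = π t ∈ Λ̄`) whose
horoball goes out to `s`: `k (A • τ) → s` as `Im τ → ∞`.  Then `π t · μ = μ · qⁿ` for some `μ ∈ Λ̄`,
`n ∈ ℤ`.  Proof: on a deep half-plane the chart coordinate of `k ∘ A` is `φ s + (r/2) e^{W}` for a
holomorphic logarithm `W`; `τ ↦ G̃ (W τ / 2πi)` is then a second `k`-lift of `k ∘ A`, so it is
`μ⁻¹ • A • τ` for ONE `μ ∈ Λ̄` (lifts agree up to a deck transformation on the connected half-plane);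
translating `τ` by `h` changes `W` by `2πi n`.
[cite: FarkasKra1992, IV.5.5–IV.5.6] [cite: MochizukiAbsTopIII2015, Proposition 4.2 (i) proof p.106] -/
theorem exists_conj_zpow_of_tendsto (U : Opens M) (hU : IsConnected (U : Set M)) {s : M}
    (hs : s ∉ (U : Set M))
    {k : ℍ → (ofOpens U hU).carrier} (hk : IsCoveringMap k) (dk : MDifferentiable 𝓘(ℂ, ℂ) 𝓘(ℂ, ℂ) k)
    (Λ : Subgroup PSL2R) [IsCancelSMul Λ ℍ]
    (hΛ : ∀ q : PSL2R, q ∈ Λ ↔ ∀ τ : ℍ, k (q • τ) = k τ)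
    (hfib : ∀ τ τ' : ℍ, k τ = k τ' → ∃ q ∈ Λ, q • τ = τ')
    {r : ℝ} (hr : 0 < r)
    {Gt : ℍ → ℍ} (hGt : Continuous Gt) {q : PSL2R} (hq : q ∈ Λ)
    (hGlift : ∀ w : ℍ, (k (Gt w)).1 =
      (extChartAt 𝓘(ℂ, ℂ) s).symm (extChartAt 𝓘(ℂ, ℂ) s s + ((r / 2 : ℝ) : ℂ) * exp (2 * π * I * w)))
    (hGdeck : ∀ w w' : ℍ, (w' : ℂ) = w + 1 → Gt w' = q • Gt w)
    (A : SL(2, ℝ)) {h : ℝ} {t : SL(2, ℝ)}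
    (ht : (QuotientGroup.mk' (Subgroup.center SL(2, ℝ)) t : PSL2R) ∈ Λ)
    (hAt : (QuotientGroup.mk' (Subgroup.center SL(2, ℝ)) (A * translSL h * A⁻¹) : PSL2R) =
      QuotientGroup.mk' (Subgroup.center SL(2, ℝ)) t)
    (hlim : Tendsto (fun τ : ℍ => (k (A • τ)).1) (comap UpperHalfPlane.im atTop) (𝓝 s)) :
    ∃ (μ : PSL2R) (n : ℤ), μ ∈ Λ ∧
      (QuotientGroup.mk' (Subgroup.center SL(2, ℝ)) t : PSL2R) * μ = μ * q ^ n := by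
  classical
  set φ := extChartAt 𝓘(ℂ, ℂ) s with hφ
  set c₀ : ℂ := φ s with hc₀
  set πt : PSL2R := (QuotientGroup.mk' (Subgroup.center SL(2, ℝ)) t : PSL2R) with hπt
  have hI : (2 * (π : ℂ) * I) ≠ 0 := by simp [Real.pi_ne_zero, I_ne_zero]
  have hr2 : ((r / 2 : ℝ) : ℂ) ≠ 0 := by exact_mod_cast (half_pos hr).ne'
  -- §a deep points land in the chart neighbourhood `φ⁻¹ (ball c₀ (r/2))` of `s`
  have hVn : φ.source ∩ φ ⁻¹' ball c₀ (r / 2) ∈ 𝓝 s :=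
    inter_mem (extChartAt_source_mem_nhds (I := 𝓘(ℂ, ℂ)) s)
      ((continuousAt_extChartAt (I := 𝓘(ℂ, ℂ)) s).preimage_mem_nhds (ball_mem_nhds _ (half_pos hr)))
  obtain ⟨C, hC⟩ : ∃ C : ℝ, ∀ τ : ℍ, C < τ.im →
      (k (A • τ)).1 ∈ φ.source ∧ φ (k (A • τ)).1 ∈ ball c₀ (r / 2) := by
    obtain ⟨T, hT, hTV⟩ := mem_comap.mp (hlim hVn)
    obtain ⟨b, hb⟩ := mem_atTop_sets.mp hT
    exact ⟨b, fun τ hτ => hTV (hb τ.im hτ.le)⟩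
  set C₁ : ℝ := max C 0 with hC₁
  have hC' : ∀ τ : ℍ, C₁ < τ.im →
      (k (A • τ)).1 ∈ φ.source ∧ φ (k (A • τ)).1 ∈ ball c₀ (r / 2) := fun τ hτ =>
    hC τ (lt_of_le_of_lt (le_max_left C 0) hτ)
  -- §b the chart coordinate `u` of `k ∘ A` and `Qf = (u - c₀) / (r/2)` on the half-plane `D`
  let u : ℂ → ℂ := fun w => if hw : 0 < w.im then φ (k (A • UpperHalfPlane.mk w hw)).1 else 0
  have hu : ∀ τ : ℍ, u τ = φ (k (A • τ)).1 := fun τ => by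
    have hτ : 0 < (τ : ℂ).im := τ.im_pos
    simp only [u, dif_pos hτ, UpperHalfPlane.mk_coe]
  let D : Set ℂ := {w : ℂ | C₁ < w.im}
  have hDopen : IsOpen D := isOpen_lt continuous_const Complex.continuous_im
  have hDpos : ∀ w ∈ D, 0 < w.im := fun w hw => lt_of_le_of_lt (le_max_right C 0) hw
  have hcoeD : ∀ τ : ℍ, C₁ < τ.im → (τ : ℂ) ∈ D := fun τ hτ => by
    show C₁ < (τ : ℂ).im
    rwa [UpperHalfPlane.coe_im]
  let Qf : ℂ → ℂ := fun w => (u w - c₀) / ((r / 2 : ℝ) : ℂ)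
  -- values of `Qf` on `D` lie in the punctured unit disc
  have hQmem : ∀ w ∈ D, ‖Qf w‖ < 1 ∧ Qf w ≠ 0 := by
    intro w hw
    have hw0 := hDpos w hw
    have hwim : C₁ < (UpperHalfPlane.mk w hw0).im := hw
    obtain ⟨hsrc', hball'⟩ := hC' (UpperHalfPlane.mk w hw0) hwim
    have huw : u w = φ (k (A • UpperHalfPlane.mk w hw0)).1 := by simp only [u, dif_pos hw0]
    constructor
    · show ‖(u w - c₀) / ((r / 2 : ℝ) : ℂ)‖ < 1
      rw [norm_div, Complex.norm_real, Real.norm_eq_abs, abs_of_pos (half_pos hr),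
        div_lt_one (half_pos hr), huw, ← dist_eq_norm]
      exact mem_ball.mp hball'
    · show (u w - c₀) / ((r / 2 : ℝ) : ℂ) ≠ 0
      rw [div_ne_zero_iff, sub_ne_zero, huw]
      refine ⟨fun heq => hs ?_, hr2⟩
      have hks : (k (A • UpperHalfPlane.mk w hw0)).1 = s :=
        φ.injOn hsrc' (mem_extChartAt_source (I := 𝓘(ℂ, ℂ)) s) heq
      rw [← hks]
      exact (k (A • UpperHalfPlane.mk w hw0)).2
  -- §c holomorphy of `u`, hence of `Qf`, on `D`
  have hAd : MDifferentiable 𝓘(ℂ, ℂ) 𝓘(ℂ, ℂ) (fun τ : ℍ => A • τ) :=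
    (contMDiff_sl_smul A).mdifferentiable (by simp)
  have hval : ∀ τ : ℍ, MDifferentiableAt 𝓘(ℂ, ℂ) 𝓘(ℂ, ℂ) (fun σ : ℍ => (k (A • σ)).1) τ := by
    intro τ
    have h1 : MDifferentiableAt 𝓘(ℂ, ℂ) 𝓘(ℂ, ℂ) (fun σ : ℍ => k (A • σ)) τ := (dk _).comp τ (hAd τ)
    have h2 : MDifferentiableAt 𝓘(ℂ, ℂ) 𝓘(ℂ, ℂ) (Subtype.val ∘ fun σ : ℍ => k (A • σ)) τ ↔
        MDifferentiableAt 𝓘(ℂ, ℂ) 𝓘(ℂ, ℂ) (fun σ : ℍ => k (A • σ)) τ :=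
      ChartedSpace.liftPropWithinAt_subtypeVal_comp_iff ..
    exact h2.mpr h1
  have hφd : ∀ τ : ℍ, C₁ < τ.im →
      MDifferentiableAt 𝓘(ℂ, ℂ) 𝓘(ℂ, ℂ) (fun σ : ℍ => φ (k (A • σ)).1) τ := by
    intro τ hτ
    have hsrc' := (hC' τ hτ).1
    have h2 : MDifferentiableAt 𝓘(ℂ, ℂ) 𝓘(ℂ, ℂ) φ (k (A • τ)).1 := by
      rw [hφ]
      refine mdifferentiableAt_extChartAt ?_
      rw [← extChartAt_source (I := 𝓘(ℂ, ℂ))]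
      exact hsrc'
    exact h2.comp τ (hval τ)
  have hudiff : DifferentiableOn ℂ u D := by
    intro w hw
    have hw0 := hDpos w hw
    have hwim : C₁ < (UpperHalfPlane.mk w hw0).im := hw
    have h1 := UpperHalfPlane.mdifferentiableAt_iff.mp (hφd (UpperHalfPlane.mk w hw0) hwim)
    rw [UpperHalfPlane.coe_mk] at h1
    have h2 : (fun z : ℂ => φ (k (A • UpperHalfPlane.ofComplex z)).1) =ᶠ[𝓝 w] u := by
      filter_upwards [isOpen_upperHalfPlaneSet.mem_nhds hw0] with z hz
      have hz : 0 < z.im := hz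
      rw [UpperHalfPlane.ofComplex_apply_of_im_pos hz]
      simp only [u, dif_pos hz]
    exact (h1.congr_of_eventuallyEq h2.symm).differentiableWithinAt
  have hQdiff : DifferentiableOn ℂ Qf D := (hudiff.sub_const c₀).div_const _
  -- §d a holomorphic logarithm `W` of `Qf` on the convex open `D`
  obtain ⟨w₀, hw₀⟩ : ∃ w₀ : ℂ, w₀ ∈ D := by
    refine ⟨((C₁ + 1 : ℝ) : ℂ) * I, ?_⟩
    show C₁ < ((((C₁ + 1 : ℝ) : ℂ) * I).im)
    simp
  obtain ⟨W, hWd, -, hWexp⟩ :=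
    Literature.Analysis.Complex.exists_differentiableOn_exp_eq_of_starConvex hDopen
      ((convex_halfSpace_im_gt C₁).starConvex hw₀) hw₀ hQdiff (fun w hw => (hQmem w hw).2)
      (Complex.exp_log (hQmem w₀ hw₀).2)
  -- `Re W < 0`, so `W / 2πi ∈ ℍ`
  have hWim : ∀ w ∈ D, 0 < (W w / (2 * π * I)).im := by
    intro w hw
    have hlt : Real.exp (W w).re < 1 := by
      rw [← Complex.norm_exp, hWexp w hw]
      exact (hQmem w hw).1
    have hre : (W w).re < 0 := by rwa [← Real.exp_zero, Real.exp_lt_exp] at hlt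
    have e : W w / (2 * π * I) = -(W w / (2 * π)) * I := by
      field_simp
      rw [I_sq]
      ring
    rw [e, mul_I_im, neg_re]
    have : (W w / (2 * π)).re = (W w).re / (2 * π) := by
      have : (2 * (π : ℂ)) = ((2 * π : ℝ) : ℂ) := by push_cast; ring
      rw [this, Complex.div_ofReal_re]
    rw [this]
    have hπ : 0 < 2 * π := by positivity
    exact neg_pos.mpr (div_neg_of_neg_of_pos hre hπ)
  -- §e the second lift `Ψ τ = G̃ (W τ / 2πi)` on the half-plane `D' = {Im τ > C₁} ⊆ ℍ`
  let D' : Set ℍ := {τ : ℍ | C₁ < τ.im}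
  let σ : D' → ℍ := fun τ => UpperHalfPlane.mk (W (τ.1 : ℂ) / (2 * π * I)) (hWim _ (hcoeD τ.1 τ.2))
  have hσcoe : ∀ τ : D', ((σ τ : ℍ) : ℂ) = W (τ.1 : ℂ) / (2 * π * I) := fun τ => rfl
  let Ψ : D' → ℍ := fun τ => Gt (σ τ)
  have hΨk : ∀ τ : D', k (Ψ τ) = k (A • (τ.1 : ℍ)) := by
    intro τ
    have hτD := hcoeD τ.1 τ.2
    apply Subtype.ext
    show (k (Gt (σ τ))).1 = (k (A • (τ.1 : ℍ))).1
    rw [hGlift, hσcoe, mul_div_cancel₀ _ hI, hWexp _ hτD]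
    show φ.symm (c₀ + ((r / 2 : ℝ) : ℂ) * ((u (τ.1 : ℂ) - c₀) / ((r / 2 : ℝ) : ℂ))) = (k (A • (τ.1 : ℍ))).1
    rw [mul_div_cancel₀ _ hr2, add_sub_cancel, hu, φ.left_inv (hC' τ.1 τ.2).1]
  have hΨc : Continuous Ψ := by
    refine hGt.comp ?_
    rw [UpperHalfPlane.isEmbedding_coe.continuous_iff]
    have e : ((↑) : ℍ → ℂ) ∘ σ = fun τ : D' => W (τ.1 : ℂ) / (2 * π * I) := rfl
    rw [e]
    refine Continuous.div_const ?_ _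
    exact hWd.continuousOn.comp_continuous
      (UpperHalfPlane.continuous_coe.comp continuous_subtype_val) fun τ => hcoeD τ.1 τ.2
  -- §f ONE deck element `μ` with `A • τ = μ • Ψ τ` on all of `D'`
  obtain ⟨τ₀, hτ₀⟩ := exists_lt_im' C₁
  obtain ⟨μ, hμ, hμ0⟩ := hfib (Ψ ⟨τ₀, hτ₀⟩) (A • τ₀) (hΨk ⟨τ₀, hτ₀⟩)
  haveI : PreconnectedSpace D' := Subtype.preconnectedSpace (isPreconnected_setOf_lt_im' C₁)
  have hlifts : (fun τ : D' => A • (τ.1 : ℍ)) = fun τ : D' => μ • Ψ τ := by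
    refine hk.eq_of_comp_eq ((continuous_const_smul A).comp continuous_subtype_val)
      ((continuous_const_smul μ).comp hΨc) ?_ ⟨τ₀, hτ₀⟩ hμ0.symm
    funext τ
    show k (A • (τ.1 : ℍ)) = k (μ • Ψ τ)
    rw [(hΛ μ).mp hμ, hΨk]
  -- §g translate by `h`: `A • (τ₀ + h) = t • (A • τ₀)` and `W` jumps by `2πi n`
  obtain ⟨τ₁, hτ₁⟩ := exists_coe_eq_add τ₀ h
  have hτ₁D : C₁ < τ₁.im := by
    have e : (τ₁ : ℂ).im = (τ₀ : ℂ).im := by rw [hτ₁]; simp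
    rw [UpperHalfPlane.coe_im, UpperHalfPlane.coe_im] at e
    rw [e]
    exact hτ₀
  have hAτ₁ : A • τ₁ = πt • (A • τ₀) := by
    have e1 : translSL h • τ₀ = τ₁ := UpperHalfPlane.ext (by rw [coe_translSL_smul, hτ₁])
    rw [← e1, ← mul_smul, show A * translSL h = A * translSL h * A⁻¹ * A by group, mul_smul,
      ← psl_mk_smul (A * translSL h * A⁻¹), ← QuotientGroup.mk'_apply, hAt]
  have hu₁ : u τ₁ = u τ₀ := by
    rw [hu, hu, hAτ₁, hπt, (hΛ _).mp ht]
  have hexp : exp (W τ₁) = exp (W τ₀) := by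
    rw [hWexp _ (hcoeD τ₁ hτ₁D), hWexp _ (hcoeD τ₀ hτ₀)]
    show (u τ₁ - c₀) / ((r / 2 : ℝ) : ℂ) = (u τ₀ - c₀) / ((r / 2 : ℝ) : ℂ)
    rw [hu₁]
  obtain ⟨n, hn⟩ := Complex.exp_eq_exp_iff_exists_int.mp hexp
  have hσ : ((σ ⟨τ₁, hτ₁D⟩ : ℍ) : ℂ) = (σ ⟨τ₀, hτ₀⟩ : ℍ) + n := by
    rw [hσcoe, hσcoe]
    show W τ₁ / (2 * π * I) = W τ₀ / (2 * π * I) + n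
    rw [hn, add_div, mul_div_cancel_right₀ _ hI]
  have hΨ₁ : Ψ ⟨τ₁, hτ₁D⟩ = q ^ n • Ψ ⟨τ₀, hτ₀⟩ := smul_zpow_of_deck hGdeck n _ _ hσ
  -- §h compare the two expressions for `A • τ₁`
  have e0 : A • τ₀ = μ • Ψ ⟨τ₀, hτ₀⟩ := congrFun hlifts ⟨τ₀, hτ₀⟩
  have e1 : A • τ₁ = μ • Ψ ⟨τ₁, hτ₁D⟩ := congrFun hlifts ⟨τ₁, hτ₁D⟩
  have key : (πt * μ) • Ψ ⟨τ₀, hτ₀⟩ = (μ * q ^ n) • Ψ ⟨τ₀, hτ₀⟩ := by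
    rw [mul_smul, mul_smul, ← e0, ← hΨ₁, ← e1, hAτ₁]
  refine ⟨μ, n, hμ, ?_⟩
  have key' : (⟨πt * μ, Λ.mul_mem ht hμ⟩ : Λ) • Ψ ⟨τ₀, hτ₀⟩ =
      (⟨μ * q ^ n, Λ.mul_mem hμ (Λ.zpow_mem hq n)⟩ : Λ) • Ψ ⟨τ₀, hτ₀⟩ := key
  exact congrArg Subtype.val (IsCancelSMul.right_cancel _ _ _ key')

end Compare

end HolRS

end Literature.AnabelianGeometry.AbsoluteAnabelian

end
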